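import Mathlib

/-!
# Venture HSemireg — W4 widening, representation-first seat: the BLOCK IDENTITY behind the frame theorem

HONEST FRAMING. Lean index of the computation cell `pub-hsemireg` (W4 seat w4-rep-2, gen 9; doc of record
`widen/W4/w4rep2/g9/KERNEL-w4rep2g9.md` §1 Step 1(ii)). A finite identity over `ZMod 3` in an arbitrary commutative ring;
no theta function, no abelian surface and no Hodge-theoretic statement is formalised here, and nothing in this file says
HC, HC_CM or HC_AV is proved. No `sorry`, no axiom beyond the standard three, no named fact.

CONTEXT (informal, not formalised). For the «Family-I′» cells `(m, 3m)@(2m-1)` with `m ≡ 1 (mod 3)` of the W4 law, the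
three template sections of `N^m` vanishing on a Lagrangian `(2m-1)`-torsion coset have a `3 × 3m²` coefficient matrix whose
`3 × 3` blocks are signed cross-product matrices of vectors `Q = (Q 0, Q 1, Q 2)` of theta values; the frame theorem
(independence of the three sections at every period matrix and every translate) starts from the fact that `(Q 0, Q 2, Q 1)`
is a left null vector of every block. Written out, that fact is the identity below: for every column index `b : ZMod 3`,
`∑ φ, χ₃(b - φ) · Q φ · Q (-φ - b) = 0`, where `χ₃` is the Legendre symbol modulo 3. The involution `φ ↦ -φ - b` of
`ZMod 3` fixes the unordered pair `{Q φ, Q (-φ - b)}` and reverses the sign of `χ₃ (b - φ)`, and its fixed point carries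
`χ₃ 0 = 0`; the proof below simply lets Lean check the three cases.
-/

namespace Summit.Ventures.HSemireg.FamilyIPrimeBlock

/-- The Legendre symbol modulo 3 as an integer-valued function on `ZMod 3`:
`χ₃ 0 = 0`, `χ₃ 1 = 1`, `χ₃ 2 = -1`. -/
def chi3 : ZMod 3 → ℤ
  | 0 => 0
  | 1 => 1
  | 2 => -1

/-- `χ₃` is odd: `χ₃ (-x) = -χ₃ x`. -/
theorem chi3_neg (x : ZMod 3) : chi3 (-x) = -chi3 x := by
  fin_cases x <;> decide

/-- A sum over `ZMod 3` is the sum of the three values. -/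
theorem sum_zmod3 {R : Type*} [AddCommMonoid R] (f : ZMod 3 → R) :
    ∑ φ : ZMod 3, f φ = f 0 + f 1 + f 2 :=
  Fin.sum_univ_three f

/-- THE BLOCK IDENTITY. For every commutative ring `R`, every `Q : ZMod 3 → R` and every `b : ZMod 3`,
`∑ φ, χ₃(b - φ) · Q φ · Q (-φ - b) = 0`; i.e. the vector `(Q 0, Q 2, Q 1)` is a left null vector of the block
whose `(φ, b)` entry is `χ₃(b + φ') Q(φ' - b)`-shaped (doc §1 Step 1(ii), after the substitution `φ' = -φ`). -/
theorem block_identity {R : Type*} [CommRing R] (Q : ZMod 3 → R) (b : ZMod 3) :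
    ∑ φ : ZMod 3, (chi3 (b - φ) : R) * Q φ * Q (-φ - b) = 0 := by
  rw [sum_zmod3]
  have neg1 : (-1 : ZMod 3) = 2 := by decide
  have neg2 : (-2 : ZMod 3) = 1 := by decide
  have s21 : (2 : ZMod 3) - 1 = 1 := by decide
  have s12 : (1 : ZMod 3) - 2 = 2 := by decide
  have c0 : chi3 0 = 0 := by decide
  have c1 : chi3 1 = 1 := by decide
  have c2 : chi3 2 = -1 := by decide
  have hb : ∀ x : ZMod 3, x = 0 ∨ x = 1 ∨ x = 2 := by decide
  rcases hb b with rfl | rfl | rfl <;>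
    simp only [zero_sub, sub_zero, sub_self, neg_zero, neg1, neg2, s21, s12, c0, c1, c2] <;>
    push_cast <;>
    ring

/-- The same identity in the indexing of the doc (`θ`-rows, `Leg(b + θ)` weights, entries `Q (θ - b)` and the
null vector `λ_θ = Q (-θ)`): `∑ θ, χ₃(b + θ) · Q (-θ) · Q (θ - b) = 0`. -/
theorem block_identity' {R : Type*} [CommRing R] (Q : ZMod 3 → R) (b : ZMod 3) :
    ∑ θ : ZMod 3, (chi3 (b + θ) : R) * Q (-θ) * Q (θ - b) = 0 := by
  have h := block_identity Q b
  rw [sum_zmod3] at h ⊢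
  have neg1 : (-1 : ZMod 3) = 2 := by decide
  have neg2 : (-2 : ZMod 3) = 1 := by decide
  have a21 : (2 : ZMod 3) + 1 = 0 := by decide
  have a12 : (1 : ZMod 3) + 2 = 0 := by decide
  have a11 : (1 : ZMod 3) + 1 = 2 := by decide
  have a22 : (2 : ZMod 3) + 2 = 1 := by decide
  have s21 : (2 : ZMod 3) - 1 = 1 := by decide
  have s12 : (1 : ZMod 3) - 2 = 2 := by decide
  have s01 : (0 : ZMod 3) - 1 = 2 := by decide
  have s02 : (0 : ZMod 3) - 2 = 1 := by decide
  have c0 : chi3 0 = 0 := by decide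
  have c1 : chi3 1 = 1 := by decide
  have c2 : chi3 2 = -1 := by decide
  have hb : ∀ x : ZMod 3, x = 0 ∨ x = 1 ∨ x = 2 := by decide
  rcases hb b with rfl | rfl | rfl <;>
    simp only [sub_zero, sub_self, neg_zero, zero_add, add_zero, neg1, neg2, a21, a12, a11, a22,
      s21, s12, s01, s02, c0, c1, c2] at h ⊢ <;>
    push_cast at h ⊢ <;>
    linear_combination h

end Summit.Ventures.HSemireg.FamilyIPrimeBlock
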